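import Mathlib.Algebra.Polynomial.BigOperators
import Mathlib.Algebra.Polynomial.Degree.Lemmas
import Mathlib.FieldTheory.Finite.Basic
import HarnessLib

/-!
# NO CANCELLATION AMONG DISTINCT DEGREES (engine of the root-curve argument for LEMMA C′)
# (door `HypersurfaceCentreConstruction`, stmt-ResolutionOfSingularities-19897; first step of LEMMA C′, memo RESIDUE-PLAN.md §3b)

Helper for `stub_keyRungGrHomLE_three` (def-free, `--supports 19897`).  Pure one-variable polynomial algebra over a field:

* `Polynomial3.eq_zero_of_natDegree_injOn` — NO CANCELLATION: a finite sum of polynomials whose non-zero terms have pairwise distinct degrees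
  vanishes only if every term does.

This is the engine of the degree comparisons in the root-curve proof of LEMMA C′ (`r₂ ∣ r₁`): specialising the functional equation
`Φ(V,Y) = Φ(V+T, Y+τ)` at `V = Y = 0` gives `Σ_c λ_c W^{ν−c} τ₀^c = 0` with `W = ε^ρ X^{jρ}`, `τ₀ = τ(X, 0)`; the terms have degrees
`νD + c(d − D)`, pairwise distinct unless `d = deg τ₀ = D = deg W`, etc.
[OURS · L1 W4.3 · (o70-b)/(Δ12); AI work, weaker than expert review; nothing here is a statement of the manuscript under review.]
-/

noncomputable section

open Polynomial

set_option linter.dupNamespace false -- mandated namespace of this single-conjunct summit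

namespace Summit.ResolutionOfSingularities.ResolutionOfSingularities.Cruxes.HypersurfaceCentreConstruction.LocalEngine

namespace Iota3

namespace Polynomial3

variable {κ : Type} [Field κ]

/-- **No cancellation among distinct degrees**: if the non-zero terms of a finite family of polynomials have pairwise distinct
`natDegree`, and the sum vanishes, then every term vanishes. [folklore] -/
theorem eq_zero_of_natDegree_injOn {ι : Type} (s : Finset ι) (f : ι → κ[X])
    (hdist : ∀ i ∈ s, ∀ i' ∈ s, i ≠ i' → f i ≠ 0 → f i' ≠ 0 → (f i).natDegree ≠ (f i').natDegree)
    (hsum : ∑ i ∈ s, f i = 0) : ∀ i ∈ s, f i = 0 := by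
  classical
  by_contra hne
  push Not at hne
  -- a non-zero term of maximal degree
  obtain ⟨i₀, hi₀, hmax⟩ := Finset.exists_max_image (s.filter fun i => f i ≠ 0) (fun i => (f i).natDegree)
    (by obtain ⟨i, hi, hfi⟩ := hne; exact ⟨i, Finset.mem_filter.mpr ⟨hi, hfi⟩⟩)
  obtain ⟨hi₀s, hfi₀⟩ := Finset.mem_filter.mp hi₀
  -- the rest has smaller degree
  have hrest : (∑ i ∈ s.erase i₀, f i).natDegree < (f i₀).natDegree ∨ ∑ i ∈ s.erase i₀, f i = 0 := by
    by_cases hz : ∀ i ∈ s.erase i₀, f i = 0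
    · exact Or.inr (Finset.sum_eq_zero hz)
    · left
      push Not at hz
      have hlt : ∀ i ∈ s.erase i₀, f i ≠ 0 → (f i).natDegree < (f i₀).natDegree := by
        intro i hi hfi
        obtain ⟨hii₀, his⟩ := Finset.mem_erase.mp hi
        have hle := hmax i (Finset.mem_filter.mpr ⟨his, hfi⟩)
        exact lt_of_le_of_ne hle (hdist i his i₀ hi₀s hii₀ hfi hfi₀)
      have hpos : 0 < (f i₀).natDegree := by
        obtain ⟨i, hi, hfi⟩ := hz
        exact lt_of_le_of_lt (Nat.zero_le _) (hlt i hi hfi)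
      refine lt_of_le_of_lt (Polynomial.natDegree_sum_le_of_forall_le _ _ (n := (f i₀).natDegree - 1) ?_) (by omega)
      intro i hi
      by_cases hfi : f i = 0
      · rw [hfi, natDegree_zero]; exact Nat.zero_le _
      · have := hlt i hi hfi; omega
  have hsplit : f i₀ + ∑ i ∈ s.erase i₀, f i = 0 := by rw [Finset.add_sum_erase _ _ hi₀s]; exact hsum
  rcases hrest with hlt | hz
  · have h1 : f i₀ = -∑ i ∈ s.erase i₀, f i := eq_neg_of_add_eq_zero_left hsplit
    have h2 : (f i₀).natDegree = (∑ i ∈ s.erase i₀, f i).natDegree := by rw [h1, natDegree_neg]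
    omega
  · rw [hz, add_zero] at hsplit
    exact hfi₀ hsplit

end Polynomial3

end Iota3

end Summit.ResolutionOfSingularities.ResolutionOfSingularities.Cruxes.HypersurfaceCentreConstruction.LocalEngine

end
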